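import Literature.MathematicalPhysics.QuantumManyBody.LHYRiemannSum
import Literature.MathematicalPhysics.QuantumManyBody.LeeHuangYangIntegral
import Literature.MathematicalPhysics.QuantumManyBody.NeumannSymmetrization
import HarnessLib

/-!
# The Bogoliubov zero-point sum over the Neumann lattice is the LHY energy (FGJMOT Lemma 8.1, end)

Topic `Literature/MathematicalPhysics/QuantumManyBody`, namespace `BoseGas` (provefact
`Literature.MathematicalPhysics.QuantumManyBody.BoseGas.Junge2026_neumannBox_pinnedLowerBound`; brick:
the last two displays of the proof of [FournaisEtAl2024, Lemma 8.1] in physical units). With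
`lhy_correction_integral` (`½(2π)⁻³∫_{ℝ³}F = 4πρ²a·(128/15√π)√(ρa³)`,
`F(p) = √(p⁴+16πρap²) - p² - 8πρa + (8πρa)²/(2p²)`) and the Riemann-sum estimate
`abs_lhyRiemannSum_sub_integral_le_scaled` on the Neumann lattice `(π/ℓ)ℕ₀³` we obtain

* `integral_octant_radial` — `∫_{ℝ₊³} F(|q|)dq = ⅛∫_{ℝ³} F(|q|)dq` (the eight coordinate
  reflections);
* `FournaisEtAl2024_lemma81_latticeSum` — **for `ρ, a, ℓ > 0` with `π/ℓ ≤ ½√(8πρa)`: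
  `|½ℓ⁻³ Σ_{k∈ℕ₀³∖0} F((π/ℓ)|k|) - 4πρ²a·(128/15√π)√(ρa³)| ≤ (135/π²)(8πρa)²ℓ⁻¹(1 + |log(π/(ℓ√(8πρa)))|)`**,
  i.e. `½|Λ|⁻¹Σ_{p∈Λ*₊}(√(p⁴+16πρap²) - p² - 8πρa + (8πρa)²/(2p²))` is the Lee–Huang–Yang energy
  density up to `C(ρa)^{5/2}K_ℓ⁻¹ log K_ℓ`, `K_ℓ = ℓ√(ρa)` (the paper needs `K_ℓ^{-1/4}`).

No definitions.

## References

* [FournaisEtAl2024] S. Fournais, L. Junge, T. Girardot, L. Morin, M. Olivieri, A. Triay, *The free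
  energy of dilute Bose gases at low temperatures interacting via strong potentials*,
  arXiv:2408.14222, Ann. Henri Poincaré (2026): Lemma 8.1 (proof, last two displays), Cor. 2.13.
-/

noncomputable section

open Real MeasureTheory Set Finset
open scoped BigOperators

namespace Literature.MathematicalPhysics.QuantumManyBody.BoseGas

open Literature.MathematicalPhysics.QuantumManyBody.NeumannBox

/-! ### The octant integral of a radial function -/

/-- **`∫_{ℝ₊³} F(|q|) dq = ⅛ ∫_{ℝ³} F(|q|) dq`**: the eight reflected octants cover `ℝ³` up to the
null coordinate planes and have equal integrals. [folklore] -/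
theorem integral_octant_radial (F : ℝ → ℝ) (hint : Integrable fun q : Space => F ‖q‖) :
    ∫ q in {q : Space | ∀ i, 0 ≤ q i}, F ‖q‖ = 1 / 8 * ∫ q : Space, F ‖q‖ := by
  set O : (Fin 3 → ℝ) → Set Space := fun ε => {q : Space | ∀ i, 0 ≤ ε i * q i} with hO
  have hOmeas : ∀ ε, MeasurableSet (O ε) := fun ε => by
    have : O ε = ⋂ i, {q : Space | 0 ≤ ε i * q i} := by ext q; simp [hO]
    rw [this]
    exact MeasurableSet.iInter fun i => measurableSet_le measurable_const
      (measurable_const.mul ((measurable_pi_apply i).comp toCoords.measurable))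
  -- each reflected octant has the same integral
  have heq : ∀ ε ∈ signs, ∫ q in O ε, F ‖q‖ = ∫ q in {q : Space | ∀ i, 0 ≤ q i}, F ‖q‖ := by
    intro ε hε
    have h := (measurePreserving_coordFlip hε).setIntegral_preimage_emb (coordFlipEquiv hε).measurableEmbedding
      (fun q : Space => F ‖q‖) {q : Space | ∀ i, 0 ≤ q i}
    have hpre : (coordFlipEquiv hε) ⁻¹' {q : Space | ∀ i, 0 ≤ q i} = O ε := by
      ext q; simp [hO, coordFlipEquiv, coordFlip_apply]
    rw [hpre] at h
    rw [← h]
    refine setIntegral_congr_fun (hOmeas ε) fun q _ => ?_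
    show F ‖q‖ = F ‖coordFlip ε q‖
    rw [norm_coordFlip hε]
  have hcard : (signs.card : ℝ) = 8 := by rw [Fintype.card_piFinset]; norm_num
  -- the octants partition `ℝ³` a.e.
  have hsum : ∑ ε ∈ signs, ∫ q in O ε, F ‖q‖ = ∫ q : Space, F ‖q‖ := by
    calc ∑ ε ∈ signs, ∫ q in O ε, F ‖q‖ = ∑ ε ∈ signs, ∫ q, (O ε).indicator (fun q : Space => F ‖q‖) q := by
          refine Finset.sum_congr rfl fun ε _ => (integral_indicator (hOmeas ε)).symm
      _ = ∫ q, ∑ ε ∈ signs, (O ε).indicator (fun q : Space => F ‖q‖) q :=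
          (integral_finsetSum _ fun ε _ => hint.indicator (hOmeas ε)).symm
      _ = ∫ q : Space, F ‖q‖ := by
          refine integral_congr_ae ?_
          have hnull : volume {x : Space | ∃ i, x i = 0} = 0 := by
            have : {x : Space | ∃ i, x i = 0} = ⋃ i, {x : Space | x i = 0} := by ext x; simp
            rw [this]; exact measure_iUnion_null fun i => volume_coord_eq_zero i 0
          filter_upwards [compl_mem_ae_iff.2 hnull] with q hq
          simp only [mem_compl_iff, mem_setOf_eq, not_exists] at hq
          -- the unique octant containing `q`
          set ε₀ : Fin 3 → ℝ := fun i => if 0 ≤ q i then 1 else -1 with hε₀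
          have hε₀mem : ε₀ ∈ signs := Fintype.mem_piFinset.2 fun i => by
            simp only [hε₀]; split_ifs <;> simp
          have hq₀ : q ∈ O ε₀ := fun i => by
            simp only [hε₀]; split_ifs with h
            · simpa using h
            · have : q i < 0 := not_le.1 h
              nlinarith
          rw [Finset.sum_eq_single_of_mem ε₀ hε₀mem]
          · exact Set.indicator_of_mem hq₀ _
          · intro ε hε hne
            rw [Set.indicator_of_notMem]
            intro hqε
            apply hne
            funext i
            have h1 := hqε i
            rcases mem_signs hε i with h | h <;> simp only [hε₀] <;> rw [h] at h1 ⊢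
            · rw [if_pos (by simpa using h1)]
            · have : q i ≤ 0 := by nlinarith
              rw [if_neg (not_le.2 (lt_of_le_of_ne this (hq i)))]
  rw [Finset.sum_congr rfl heq, Finset.sum_const, nsmul_eq_mul, hcard] at hsum
  linarith

/-! ### The lattice sum -/

/-- **FGJMOT Lemma 8.1, the Bogoliubov zero-point sum over the Neumann lattice is the LHY energy**:
for `ρ, a, ℓ > 0` with `π/ℓ ≤ ½√(8πρa)` (i.e. `ℓ√(ρa) ≥ √(π/2)`),
`|½ℓ⁻³ Σ_{k∈ℕ₀³∖{0}} F((π/ℓ)|k|) - 4πρ²a·lhyConstant·√(ρa³)| ≤ (135/π²)(8πρa)²ℓ⁻¹(1 + |log(π/(ℓ√(8πρa)))|)`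
with `F(p) = √(p⁴+16πρap²) - p² - 8πρa + (8πρa)²/(2p²)` and `lhyConstant = 128/(15√π)` — the
paper's "we approximate the sum by the integral ... `≤ C(ρ_za)³ℓ⁻¹ ≤ CK_ℓ^{-1/4}(ρa)^{5/2}`" and
"it is a standard result that `∫p²G(8πρ_za/p²) = -64π⁴(128/15√π)(ρ_za)^{5/2}`", here with the error
`C(ρa)^{5/2}K_ℓ⁻¹(1 + log K_ℓ)`, `K_ℓ = ℓ√(ρa)`. [cite: FournaisEtAl2024, Lemma 8.1 (proof, last two displays); Cor. 2.13] -/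
theorem FournaisEtAl2024_lemma81_latticeSum {ρ a ℓ : ℝ} (hρ : 0 < ρ) (ha : 0 < a) (hℓ : 0 < ℓ)
    (hKℓ : Real.pi / ℓ ≤ Real.sqrt (8 * Real.pi * ρ * a) / 2) :
    |1 / 2 * (ℓ ^ 3)⁻¹ * ∑' k : Fin 3 → ℕ, (if k = 0 then 0 else
          (Real.sqrt ((Real.pi / ℓ * ‖(WithLp.toLp 2 (fun i => (k i : ℝ)) : Space)‖) ^ 4 +
                16 * Real.pi * ρ * a * (Real.pi / ℓ * ‖(WithLp.toLp 2 (fun i => (k i : ℝ)) : Space)‖) ^ 2) -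
              (Real.pi / ℓ * ‖(WithLp.toLp 2 (fun i => (k i : ℝ)) : Space)‖) ^ 2 - 8 * Real.pi * ρ * a +
            (8 * Real.pi * ρ * a) ^ 2 / (2 * (Real.pi / ℓ * ‖(WithLp.toLp 2 (fun i => (k i : ℝ)) : Space)‖) ^ 2))) -
        4 * Real.pi * ρ ^ 2 * a * lhyConstant * Real.sqrt (ρ * a ^ 3)| ≤
      135 / Real.pi ^ 2 * (8 * Real.pi * ρ * a) ^ 2 * ℓ⁻¹ *
        (1 + |Real.log (Real.pi / ℓ / Real.sqrt (8 * Real.pi * ρ * a))|) := by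
  set lam : ℝ := 8 * Real.pi * ρ * a with hlam
  have hlam0 : 0 < lam := by positivity
  set h : ℝ := Real.pi / ℓ with hh
  have hh0 : 0 < h := by positivity
  have hpi := Real.pi_pos
  -- the Riemann-sum estimate, with the summand in the physical form
  have hR := abs_lhyRiemannSum_sub_integral_le_scaled hlam0 hh0 hKℓ
  have hsummand : ∀ k : Fin 3 → ℕ, (if k = 0 then (0 : ℝ) else
      (Real.sqrt ((h * ‖(WithLp.toLp 2 (fun i => (k i : ℝ)) : Space)‖) ^ 4 +
          2 * lam * (h * ‖(WithLp.toLp 2 (fun i => (k i : ℝ)) : Space)‖) ^ 2) -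
        (h * ‖(WithLp.toLp 2 (fun i => (k i : ℝ)) : Space)‖) ^ 2 - lam +
        lam ^ 2 / (2 * (h * ‖(WithLp.toLp 2 (fun i => (k i : ℝ)) : Space)‖) ^ 2))) =
      (if k = 0 then (0 : ℝ) else
      (Real.sqrt ((Real.pi / ℓ * ‖(WithLp.toLp 2 (fun i => (k i : ℝ)) : Space)‖) ^ 4 +
          16 * Real.pi * ρ * a * (Real.pi / ℓ * ‖(WithLp.toLp 2 (fun i => (k i : ℝ)) : Space)‖) ^ 2) -
        (Real.pi / ℓ * ‖(WithLp.toLp 2 (fun i => (k i : ℝ)) : Space)‖) ^ 2 - 8 * Real.pi * ρ * a +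
        (8 * Real.pi * ρ * a) ^ 2 / (2 * (Real.pi / ℓ * ‖(WithLp.toLp 2 (fun i => (k i : ℝ)) : Space)‖) ^ 2))) := by
    intro k
    split_ifs
    · rfl
    · rw [hh, hlam]; ring_nf
  simp_rw [hsummand] at hR
  -- the octant integral is `⅛` of the LHY integral
  have hint : Integrable fun q : Space =>
      Real.sqrt (‖q‖ ^ 4 + 2 * lam * ‖q‖ ^ 2) - ‖q‖ ^ 2 - lam + lam ^ 2 / (2 * ‖q‖ ^ 2) :=
    integrable_bogoliubov hlam0
  have hoct := integral_octant_radial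
    (fun r => Real.sqrt (r ^ 4 + 2 * lam * r ^ 2) - r ^ 2 - lam + lam ^ 2 / (2 * r ^ 2)) hint
  beta_reduce at hoct
  have hLHY := lhy_correction_integral hρ ha
  have hI : ∫ q : Space, (Real.sqrt (‖q‖ ^ 4 + 2 * lam * ‖q‖ ^ 2) - ‖q‖ ^ 2 - lam + lam ^ 2 / (2 * ‖q‖ ^ 2)) =
      ∫ p : Space, (Real.sqrt (‖p‖ ^ 4 + 16 * Real.pi * ρ * a * ‖p‖ ^ 2) - ‖p‖ ^ 2 - 8 * Real.pi * ρ * a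
          + (8 * Real.pi * ρ * a) ^ 2 / (2 * ‖p‖ ^ 2)) := by
    refine integral_congr_ae (Filter.Eventually.of_forall fun q => ?_)
    show _ = _
    rw [hlam]; ring_nf
  -- assemble: `½ℓ⁻³S - LHY = (2π³)⁻¹ (h³S - ∫_{ℝ₊³})`
  set S := ∑' k : Fin 3 → ℕ, (if k = 0 then (0 : ℝ) else
      (Real.sqrt ((Real.pi / ℓ * ‖(WithLp.toLp 2 (fun i => (k i : ℝ)) : Space)‖) ^ 4 +
          16 * Real.pi * ρ * a * (Real.pi / ℓ * ‖(WithLp.toLp 2 (fun i => (k i : ℝ)) : Space)‖) ^ 2) -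
        (Real.pi / ℓ * ‖(WithLp.toLp 2 (fun i => (k i : ℝ)) : Space)‖) ^ 2 - 8 * Real.pi * ρ * a +
        (8 * Real.pi * ρ * a) ^ 2 / (2 * (Real.pi / ℓ * ‖(WithLp.toLp 2 (fun i => (k i : ℝ)) : Space)‖) ^ 2))) with hS
  set Ioct := ∫ q in {q : Space | ∀ i, 0 ≤ q i},
      (Real.sqrt (‖q‖ ^ 4 + 2 * lam * ‖q‖ ^ 2) - ‖q‖ ^ 2 - lam + lam ^ 2 / (2 * ‖q‖ ^ 2)) with hIoct
  have hkey : 1 / 2 * (ℓ ^ 3)⁻¹ * S - 4 * Real.pi * ρ ^ 2 * a * lhyConstant * Real.sqrt (ρ * a ^ 3) =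
      (2 * Real.pi ^ 3)⁻¹ * (h ^ 3 * S - Ioct) := by
    rw [← hLHY, ← hI, hoct, hh]
    field_simp
    ring
  rw [hkey, abs_mul, abs_of_pos (by positivity)]
  calc (2 * Real.pi ^ 3)⁻¹ * |h ^ 3 * S - Ioct| ≤ (2 * Real.pi ^ 3)⁻¹ * (270 * lam ^ 2 * h * (1 + |Real.log (h / Real.sqrt lam)|)) :=
        mul_le_mul_of_nonneg_left hR (by positivity)
    _ = 135 / Real.pi ^ 2 * lam ^ 2 * ℓ⁻¹ * (1 + |Real.log (h / Real.sqrt lam)|) := by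
        rw [hh]; field_simp; ring

end Literature.MathematicalPhysics.QuantumManyBody.BoseGas
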